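import Summits.Ventures.CertifiedManyBodySolver.Theses.CovHg1201M19

/-!
# Theorems/CovHg1201M19Assembly.lean — route «CovHg1201M19» (hubbard-cov-hg1201, the M19 @ 0 GPa optimal-doping column, p = 0.16), item `Assembly` (stmt-Ventures-27757)

`Assembly := PatchLeftEdgeM19 → PatchBottomM19 → Hg1201M19_StiffnessBoxCeiling` is the curried form of the route file's gate-written deciding theorem
`closes` (= `Downfold.Hg1201M19_StiffnessBoxCeiling_of_cornerStrip le_rfl` (hubbard-cov-hg1201-box-2 g1, p630377) ∘ the t′-cut slab (`hg1201M19_bar_kinematic_of_m53o100_le_tp`,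
hubbard-cov-hg1201-unc-3) ∘ `ObsStiffnessSeqCeilingAt_on_box_of_bottomEdge_and_leftEdge_targetSlot` with `(p, q, U_A, U_max) = (−27/50, −53/100, 7/2, 44/5)`, values `−c`,
prices trivial). Captain hubbard-cov-hg1201-plan-1 g3 RULING 2026-08-28T12:57:20Z: «M19 ASSEMBLY WRITER = box-2 g1» (hubbard-cov-hg1201-ref-1 g2's attached candidate
`fun h₁ h₂ => closes h₁ h₂`, m19/AssemblyM19Proof.lean rc 0); filed by hubbard-cov-hg1201-box-2 g1 (`prover-hubbard-cov-hg1201-box-2-g0-0`). Nothing about the two cruxes is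
claimed: the theorem is an implication, CONDITIONAL on them by construction, exactly as the item is typed.
HONEST FRAMING: glue only — certified stiffness CEILINGS on a downfolded SCREENING-GRADE box are CONTROL / CALIBRATION + labelled heuristic (wording class (xx1); «content»
= below 0.98 × the kinematic MAJORANT word `0.5188344`, no suppression below free claimed); a ceiling never speaks to the presence of superconductivity; not a `T_c` or phase
statement; nothing about HgBa₂CuO₄₊δ; no rung leaf and no summit statement is proved by this file.
-/

namespace Summit.Ventures.CertifiedManyBodySolver.Theorems

open Summit.Ventures.CertifiedManyBodySolver.Theses.CovHg1201M19

/-- **Item `Assembly` of route `CovHg1201M19`** (stmt-Ventures-27757): the left-edge bundle and the bottom bundle of the halved M19 residual strip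
`[−27/50, −53/100] × [7/2, 44/5] × [43/50, 22/25]` give the registered rung leaf «MOS2-hg1201-M19» — by the route file's deciding theorem `closes`.
[cite: ScalapinoWhiteZhang1993, §II] [cite: KomaTasaki1994, §1] -/
theorem covHg1201M19Assembly_proof : Assembly := by
  unfold Assembly
  exact fun h₁ h₂ => closes h₁ h₂

end Summit.Ventures.CertifiedManyBodySolver.Theorems
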